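import Summits.Ventures.CertifiedManyBodySolver.Theorems.R2cStripCellConsumerDyadic
import HarnessLib

/-!
# Route `R2cOpenStripTangentLine`, writer (ii) add-on 1/4 (route pen sr-mbsolver-var-7): POSITIVITY FROM LABEL BLOCKS

HONEST FRAMING: first certified bounds; not a superconductivity verdict; every number certified or labelled float.
NO NUMBER IS CLAIMED HERE. No certificate `≤ −18/25` per site at density `7/8` exists today — the route's cruxes stay OPEN.

A Hermitian form block-diagonal in integer labels is `⪰ 0` as soon as every label block is (`posSemidef_of_labelBlocks`,
`posSemidef_of_sectors`); the dual `c·1 − W(A; X, Z)` of a `U(1)`-blocked tensor with a charge-conserving bond matrix `X` and a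
label-diagonal `Z` IS label-block-diagonal (`sub_dualMatrix_apply_ne_zero_lab`, `posSemidef_sub_dualMatrix_of_sectors`) — so a
`bd-strip-cell-v1` verifier may certify it SECTOR BY SECTOR, never forming the dense `D × D` matrix. Successors:
`Upper/StripCellStructure` (charge conservation + Hermiticity of `stripCellBondMatrix`), `Upper/StripCellRowSum` (producer-free row
sums), `Theorems/R2cStripCellSectorConsumers` (the consumers). Sources: VAR `METHOD-umps.md` §2; Horn–Johnson (2013) Obs. 7.1.2
[HornJohnson2013].
-/

noncomputable section

open Matrix Finset
open scoped ComplexOrder BigOperators Kronecker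

namespace Summit.Ventures.CertifiedManyBodySolver.Upper

open Literature.MathematicalPhysics.QuantumLattice
open Literature.MathematicalPhysics.QuantumLattice.JordanWigner
open Literature.LinearAlgebra.Matrix.PolarOrthonormalization
open Summit.Ventures.CertifiedManyBodySolver.Theorems

/-! ### Part B — positivity from label blocks, block-diagonality of the dual -/

section BlockPSD

variable {D : ℕ} {L : Type*} [DecidableEq L]

/-- The restriction of a vector to the label class `q` (zero outside it). -/
def blockVec (lab : Fin D → L) (q : L) (x : Fin D → ℂ) : Fin D → ℂ :=
  fun α => if lab α = q then x α else 0

/-- Outside the label class `q` the block vector vanishes. -/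
theorem blockVec_apply_of_ne (lab : Fin D → L) (q : L) (x : Fin D → ℂ) {α : Fin D}
    (h : lab α ≠ q) : blockVec lab q x α = 0 := by
  simp [blockVec, h]

/-- The quadratic form as a double sum. -/
theorem star_dotProduct_mulVec_eq_sum (M : Matrix (Fin D) (Fin D) ℂ) (x : Fin D → ℂ) :
    star x ⬝ᵥ (M *ᵥ x) = ∑ α, ∑ β, star (x α) * M α β * x β := by
  simp only [dotProduct, mulVec, Pi.star_apply, Finset.mul_sum, mul_assoc]

/-- For a label-block-diagonal matrix the quadratic form splits over the label classes. -/
theorem star_dotProduct_mulVec_eq_sum_blocks (lab : Fin D → L) {M : Matrix (Fin D) (Fin D) ℂ}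
    (hblock : ∀ α β, M α β ≠ 0 → lab α = lab β) (x : Fin D → ℂ) :
    star x ⬝ᵥ (M *ᵥ x) =
      ∑ q ∈ Finset.univ.image lab, star (blockVec lab q x) ⬝ᵥ (M *ᵥ blockVec lab q x) := by
  have key : ∀ α β, star (x α) * M α β * x β =
      ∑ q ∈ Finset.univ.image lab, star (blockVec lab q x α) * M α β * blockVec lab q x β := by
    intro α β
    have h1 : ∀ q, star (blockVec lab q x α) * M α β * blockVec lab q x β =
        if lab α = q then (if lab β = lab α then star (x α) * M α β * x β else 0) else 0 := by
      intro q
      by_cases hα : lab α = q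
      · by_cases hβ : lab β = lab α
        · simp [blockVec, hα, hβ]
        · have hβ' : lab β ≠ q := fun h => hβ (h.trans hα.symm)
          simp [blockVec, hβ, hβ']
      · simp [blockVec, hα]
    simp_rw [h1]
    rw [Finset.sum_ite_eq, if_pos (Finset.mem_image_of_mem lab (Finset.mem_univ α))]
    by_cases hβ : lab β = lab α
    · rw [if_pos hβ]
    · have hM : M α β = 0 := by
        by_contra hM
        exact hβ (hblock α β hM).symm
      rw [if_neg hβ, hM, mul_zero, zero_mul]
  calc star x ⬝ᵥ (M *ᵥ x) = ∑ α, ∑ β, star (x α) * M α β * x β := star_dotProduct_mulVec_eq_sum M x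
    _ = ∑ α, ∑ β, ∑ q ∈ Finset.univ.image lab,
          star (blockVec lab q x α) * M α β * blockVec lab q x β := by
        simp_rw [key]
    _ = ∑ α, ∑ q ∈ Finset.univ.image lab, ∑ β,
          star (blockVec lab q x α) * M α β * blockVec lab q x β :=
        Finset.sum_congr rfl fun _ _ => Finset.sum_comm
    _ = ∑ q ∈ Finset.univ.image lab, ∑ α, ∑ β,
          star (blockVec lab q x α) * M α β * blockVec lab q x β := Finset.sum_comm
    _ = ∑ q ∈ Finset.univ.image lab, star (blockVec lab q x) ⬝ᵥ (M *ᵥ blockVec lab q x) := by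
        simp_rw [star_dotProduct_mulVec_eq_sum]

/-- **Positivity from the label blocks (abstract form).** A Hermitian label-block-diagonal matrix whose
quadratic form is nonnegative on every vector supported in one label class is positive semidefinite. -/
theorem posSemidef_of_labelBlocks (lab : Fin D → L) {M : Matrix (Fin D) (Fin D) ℂ}
    (hH : M.IsHermitian) (hblock : ∀ α β, M α β ≠ 0 → lab α = lab β)
    (hpos : ∀ (q : L) (y : Fin D → ℂ), (∀ α, lab α ≠ q → y α = 0) → 0 ≤ star y ⬝ᵥ (M *ᵥ y)) :
    M.PosSemidef := by
  refine Matrix.PosSemidef.of_dotProduct_mulVec_nonneg hH fun x => ?_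
  rw [star_dotProduct_mulVec_eq_sum_blocks lab hblock x]
  exact Finset.sum_nonneg fun q _ => hpos q _ fun α hα => blockVec_apply_of_ne lab q x hα

/-- A sum over `Fin D` of a function vanishing off the range of an injective `emb : Fin m → Fin D` is
the sum over `Fin m`. -/
theorem sum_eq_sum_comp_of_support {m : ℕ} (emb : Fin m → Fin D) (hinj : Function.Injective emb)
    (g : Fin D → ℂ) (hg : ∀ α, (∀ i, emb i ≠ α) → g α = 0) : ∑ α, g α = ∑ i, g (emb i) := by
  rw [← Finset.sum_image (f := g) (fun i _ j _ h => hinj h)]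
  symm
  refine Finset.sum_subset (Finset.subset_univ _) fun α _ hα => hg α fun i hi => ?_
  exact hα (Finset.mem_image.2 ⟨i, Finset.mem_univ _, hi⟩)

/-- The quadratic form of a vector supported in the range of `emb` is the quadratic form of the
principal submatrix. -/
theorem star_dotProduct_mulVec_of_support {m : ℕ} (emb : Fin m → Fin D)
    (hinj : Function.Injective emb) (M : Matrix (Fin D) (Fin D) ℂ) (y : Fin D → ℂ)
    (hy : ∀ α, (∀ i, emb i ≠ α) → y α = 0) :
    star y ⬝ᵥ (M *ᵥ y) = star (y ∘ emb) ⬝ᵥ (M.submatrix emb emb *ᵥ (y ∘ emb)) := by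
  rw [star_dotProduct_mulVec_eq_sum, star_dotProduct_mulVec_eq_sum]
  rw [sum_eq_sum_comp_of_support emb hinj _ ?_]
  · refine Finset.sum_congr rfl fun i _ => ?_
    rw [sum_eq_sum_comp_of_support emb hinj _ ?_]
    · simp [Matrix.submatrix_apply]
    · intro β hβ
      rw [hy β hβ, mul_zero]
  · intro α hα
    simp [hy α hα]

omit [DecidableEq L] in
/-- Nonnegativity of the quadratic form on a label class from positivity of a covering principal
submatrix. -/
theorem blockForm_nonneg_of_submatrix (lab : Fin D → L) (q : L) {m : ℕ} (emb : Fin m → Fin D)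
    (hinj : Function.Injective emb) (hcover : ∀ α, lab α = q → ∃ i, emb i = α)
    {M : Matrix (Fin D) (Fin D) ℂ} (hM : (M.submatrix emb emb).PosSemidef)
    (y : Fin D → ℂ) (hy : ∀ α, lab α ≠ q → y α = 0) : 0 ≤ star y ⬝ᵥ (M *ᵥ y) := by
  rw [star_dotProduct_mulVec_of_support emb hinj M y ?_]
  · exact hM.dotProduct_mulVec_nonneg _
  · intro α hα
    refine hy α fun hq => ?_
    obtain ⟨i, hi⟩ := hcover α hq
    exact hα i hi

/-- Hermitian from the label blocks. -/
theorem isHermitian_of_sectors (lab : Fin D → L) {M : Matrix (Fin D) (Fin D) ℂ}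
    (hblock : ∀ α β, M α β ≠ 0 → lab α = lab β) {m : L → ℕ} (emb : ∀ q, Fin (m q) → Fin D)
    (hcover : ∀ α, ∃ i, emb (lab α) i = α)
    (hherm : ∀ q ∈ Finset.univ.image lab, (M.submatrix (emb q) (emb q)).IsHermitian) :
    M.IsHermitian := by
  refine Matrix.IsHermitian.ext fun α β => ?_
  by_cases h : lab α = lab β
  · obtain ⟨i, hi⟩ := hcover α
    have hcβ : ∃ j, emb (lab α) j = β := by
      rw [h]
      exact hcover β
    obtain ⟨j, hj⟩ := hcβ
    have hq := (hherm (lab α) (Finset.mem_image_of_mem lab (Finset.mem_univ α))).apply i j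
    simpa [Matrix.submatrix_apply, hi, hj] using hq
  · have h1 : M α β = 0 := by
      by_contra hM
      exact h (hblock α β hM)
    have h2 : M β α = 0 := by
      by_contra hM
      exact h (hblock β α hM).symm
    rw [h1, h2, star_zero]

/-- **Positivity from the sectors.** A label-block-diagonal matrix on `Fin D` is positive semidefinite as
soon as, for every occurring label `q`, some injective `emb q : Fin (m q) → Fin D` covering the label
class of `q` has a positive semidefinite principal submatrix. (Labels not in the image of `lab` carry
no hypothesis; `emb` may be junk there.) -/
theorem posSemidef_of_sectors (lab : Fin D → L) {M : Matrix (Fin D) (Fin D) ℂ}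
    (hblock : ∀ α β, M α β ≠ 0 → lab α = lab β) {m : L → ℕ} (emb : ∀ q, Fin (m q) → Fin D)
    (hinj : ∀ q, Function.Injective (emb q)) (hcover : ∀ α, ∃ i, emb (lab α) i = α)
    (hpsd : ∀ q ∈ Finset.univ.image lab, (M.submatrix (emb q) (emb q)).PosSemidef) :
    M.PosSemidef := by
  refine posSemidef_of_labelBlocks lab
    (isHermitian_of_sectors lab hblock emb hcover fun q hq => (hpsd q hq).1) hblock fun q y hy => ?_
  by_cases hq : q ∈ Finset.univ.image lab
  · refine blockForm_nonneg_of_submatrix lab q (emb q) (hinj q) (fun α hα => ?_) (hpsd q hq) y hy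
    subst hα
    exact hcover α
  · have hy0 : y = 0 := by
      funext α
      refine hy α fun hα => hq ?_
      exact hα ▸ Finset.mem_image_of_mem lab (Finset.mem_univ α)
    rw [hy0, star_zero, zero_dotProduct]

end BlockPSD

section DualBlocks

variable {Q D : ℕ}

/-- Two-site words shift labels by `2ν − chg s − chg t`. -/
theorem lab_eq_of_mul_apply_ne_zero (A : MPSTensor Q D) (lab : Fin D → ℤ) (ν : ℤ) (chg : Fin Q → ℕ)
    (hlab : ∀ (S : Fin Q) (α β : Fin D), A S α β ≠ 0 → lab β + ν = lab α + chg S)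
    (s t : Fin Q) (γ α : Fin D) (h : (A s * A t) γ α ≠ 0) :
    lab α + 2 * ν = lab γ + chg s + chg t := by
  rw [Matrix.mul_apply] at h
  obtain ⟨δ, -, hδ⟩ := Finset.exists_ne_zero_of_sum_ne_zero h
  have e0 := hlab s γ δ (left_ne_zero_of_mul hδ)
  have e1 := hlab t δ α (right_ne_zero_of_mul hδ)
  linarith

/-- The bond image `Y_X` is label-block-diagonal for a charge-conserving `X`. -/
theorem bondImage_apply_ne_zero_lab (A : MPSTensor Q D) (lab : Fin D → ℤ) (ν : ℤ) (chg : Fin Q → ℕ)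
    (hlab : ∀ (S : Fin Q) (α β : Fin D), A S α β ≠ 0 → lab β + ν = lab α + chg S)
    (X : Matrix (Fin Q × Fin Q) (Fin Q × Fin Q) ℂ)
    (hX : ∀ p p', X p p' ≠ 0 → (chg p.1 : ℤ) + chg p.2 = chg p'.1 + chg p'.2)
    (α β : Fin D) (h : bondImage A X α β ≠ 0) : lab α = lab β := by
  unfold bondImage at h
  rw [Matrix.sum_apply] at h
  obtain ⟨p, -, hp⟩ := Finset.exists_ne_zero_of_sum_ne_zero h
  rw [Matrix.sum_apply] at hp
  obtain ⟨p', -, hp'⟩ := Finset.exists_ne_zero_of_sum_ne_zero hp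
  rw [Matrix.smul_apply, smul_eq_mul] at hp'
  have hXp := hX p p' (left_ne_zero_of_mul hp')
  have hm := right_ne_zero_of_mul hp'
  rw [Matrix.mul_apply] at hm
  obtain ⟨γ, -, hγ⟩ := Finset.exists_ne_zero_of_sum_ne_zero hm
  have h1 := left_ne_zero_of_mul hγ
  have h2 := right_ne_zero_of_mul hγ
  rw [Matrix.conjTranspose_apply, star_ne_zero] at h1
  have e1 := lab_eq_of_mul_apply_ne_zero A lab ν chg hlab p.1 p.2 γ α h1
  have e2 := lab_eq_of_mul_apply_ne_zero A lab ν chg hlab p'.1 p'.2 γ β h2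
  linarith

/-- The Heisenberg map `Φ(Z) = Σ_s A_sᴴ Z A_s` is label-block-diagonal for a label-block-diagonal `Z`. -/
theorem heisenberg_apply_ne_zero_lab (A : MPSTensor Q D) (lab : Fin D → ℤ) (ν : ℤ) (chg : Fin Q → ℕ)
    (hlab : ∀ (S : Fin Q) (α β : Fin D), A S α β ≠ 0 → lab β + ν = lab α + chg S)
    (Z : Matrix (Fin D) (Fin D) ℂ) (hZ : ∀ α β, Z α β ≠ 0 → lab α = lab β)
    (α β : Fin D) (h : heisenberg A Z α β ≠ 0) : lab α = lab β := by
  unfold heisenberg at h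
  rw [Matrix.sum_apply] at h
  obtain ⟨s, -, hs⟩ := Finset.exists_ne_zero_of_sum_ne_zero h
  rw [Matrix.mul_apply] at hs
  obtain ⟨δ, -, hδ⟩ := Finset.exists_ne_zero_of_sum_ne_zero hs
  have h1 := left_ne_zero_of_mul hδ
  have h2 := right_ne_zero_of_mul hδ
  rw [Matrix.mul_apply] at h1
  obtain ⟨γ, -, hγ⟩ := Finset.exists_ne_zero_of_sum_ne_zero h1
  have h3 := left_ne_zero_of_mul hγ
  have h4 := right_ne_zero_of_mul hγ
  rw [Matrix.conjTranspose_apply, star_ne_zero] at h3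
  have e1 := hlab s γ α h3
  have e2 := hZ γ δ h4
  have e3 := hlab s δ β h2
  linarith

/-- **The shifted dual matrix `c • 1 − W(A;X,Z)` is label-block-diagonal.** -/
theorem sub_dualMatrix_apply_ne_zero_lab (A : MPSTensor Q D) (lab : Fin D → ℤ) (ν : ℤ)
    (chg : Fin Q → ℕ)
    (hlab : ∀ (S : Fin Q) (α β : Fin D), A S α β ≠ 0 → lab β + ν = lab α + chg S)
    (X : Matrix (Fin Q × Fin Q) (Fin Q × Fin Q) ℂ)
    (hX : ∀ p p', X p p' ≠ 0 → (chg p.1 : ℤ) + chg p.2 = chg p'.1 + chg p'.2)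
    (Z : Matrix (Fin D) (Fin D) ℂ) (hZ : ∀ α β, Z α β ≠ 0 → lab α = lab β) (c : ℂ)
    (α β : Fin D) (h : (c • (1 : Matrix (Fin D) (Fin D) ℂ) - dualMatrix A X Z) α β ≠ 0) :
    lab α = lab β := by
  by_contra hne
  apply h
  have hαβ : α ≠ β := fun e => hne (e ▸ rfl)
  have h1 : bondImage A X α β = 0 := by
    by_contra h'
    exact hne (bondImage_apply_ne_zero_lab A lab ν chg hlab X hX α β h')
  have h2 : heisenberg A Z α β = 0 := by
    by_contra h'
    exact hne (heisenberg_apply_ne_zero_lab A lab ν chg hlab Z hZ α β h')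
  have h3 : Z α β = 0 := by
    by_contra h'
    exact hne (hZ α β h')
  simp [dualMatrix, Matrix.sub_apply, Matrix.add_apply, Matrix.smul_apply, Matrix.one_apply_ne hαβ,
    h1, h2, h3]

/-- **Per-sector certificates ⇒ the dense dual hypothesis.** For a tensor with the U(1) block rule, a
charge-conserving bond matrix `X` and a label-block-diagonal `Z`: if for every occurring label `q` an
injective `emb q` covering the class of `q` presents a positive semidefinite principal block of
`c • 1 − W(A;X,Z)`, then `(c • 1 − W(A;X,Z)) ⪰ 0` — the hypothesis `hWd` of
`m3Upper_tp0_le_m18o25_of_umpsStripCells[_dyadic]` / `Upper.polarTensor_dual_certificate_of_rowSum`. -/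
theorem posSemidef_sub_dualMatrix_of_sectors (A : MPSTensor Q D) (lab : Fin D → ℤ) (ν : ℤ)
    (chg : Fin Q → ℕ)
    (hlab : ∀ (S : Fin Q) (α β : Fin D), A S α β ≠ 0 → lab β + ν = lab α + chg S)
    (X : Matrix (Fin Q × Fin Q) (Fin Q × Fin Q) ℂ)
    (hX : ∀ p p', X p p' ≠ 0 → (chg p.1 : ℤ) + chg p.2 = chg p'.1 + chg p'.2)
    (Z : Matrix (Fin D) (Fin D) ℂ) (hZ : ∀ α β, Z α β ≠ 0 → lab α = lab β) (c : ℂ)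
    {m : ℤ → ℕ} (emb : ∀ q, Fin (m q) → Fin D) (hinj : ∀ q, Function.Injective (emb q))
    (hcover : ∀ α, ∃ i, emb (lab α) i = α)
    (hpsd : ∀ q ∈ Finset.univ.image lab,
      ((c • (1 : Matrix (Fin D) (Fin D) ℂ) - dualMatrix A X Z).submatrix (emb q) (emb q)).PosSemidef) :
    (c • (1 : Matrix (Fin D) (Fin D) ℂ) - dualMatrix A X Z).PosSemidef :=
  posSemidef_of_sectors lab (sub_dualMatrix_apply_ne_zero_lab A lab ν chg hlab X hX Z hZ c)
    emb hinj hcover hpsd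

end DualBlocks

end Summit.Ventures.CertifiedManyBodySolver.Upper

end
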